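import Summits.BirchSwinnertonDyer.Rank1Residual.X11b.CharacterSupply
import Literature.NumberTheory.LFunctions.DworkRationalitySplittingSeries
import HarnessLib

/-!
# X11b — powers of a principal unit of `ℂ_p` close to `1`: `‖x^m − 1‖ = ‖x − 1‖·‖m‖_p`, congruent
# exponents give close powers, and the "bump" polynomial `1 − (1 − eᴺ)ᴺ`

HONEST FRAMING (cell `b2b-bsdres`, run/shared/lean/b2b/bsd-rank1-residual/, verbatim in every
file): the goal of the cell is to DELETE the COMBINATION-SHAPED residual classes of the
Birch–Swinnerton-Dyer formula for ALL analytic-rank `≤ 1` elliptic curves over `ℚ` — "full BSD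
formula for every rank `≤ 1` curve in class `C`" assembled STRICTLY from published theorems — so
that the rank-`≤ 1` remainder becomes exactly the CONSTRUCTION-SHAPED classes, which are TYPED
(missing-input `Prop`s), NOT attempted. This is not "finishing BSD". Sub-cell
`b2b-bsdres-multr1-p1` (X11b, route R1, gen 25); THEOREMS ONLY (elementary `p`-adic analysis; no
definition, no named fact, no `sorry`); valid at every prime `p`; nothing here changes a label.

## Why this file (step II-a of IDEAL RIGIDITY ACROSS PERIODS, INTENT HOME/INBOX.md 2026-08-21)

The separating polynomials of step II-b live on the powers `x^k` of a principal unit `x` with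
`‖x − 1‖ < p⁻¹` and on the translates `b·x^k`. This file supplies the metric facts about such powers
(x11b3-p7's principal-unit toolkit `norm_one_sub_pow_le`, `norm_geom_sum_eq_one`,
`norm_one_sub_inv_eq` is IMPORTED and credited):

* §1 `R1.norm_natCast_padicComplex` (integer / prime twins are the tree's `Dwork.norm_intCast_padicComplex`, `Dwork.norm_natCast_p_padicComplex`);
  `R1.norm_pow_sub_one_le`; **`R1.norm_pow_prime_sub_one`** (`‖x − 1‖ < p⁻¹ ⟹ ‖x^p − 1‖ =
  p⁻¹‖x − 1‖`: `x^p − 1 = (Σ_{i<p} x^i)(x − 1)` and the sum is `p` up to terms of norm `< p⁻¹`);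
  `R1.norm_pow_prime_pow_sub_one`; `R1.norm_pow_sub_one_of_coprime`; **`R1.norm_pow_sub_one_eq`**
  (`m ≥ 1 ⟹ ‖x^m − 1‖ = ‖x − 1‖·‖m‖_p`); `R1.norm_zpow_sub_one_le` (`n : ℤ`);
  **`R1.norm_zpow_sub_zpow_le_of_dvd`** (`p^K ∣ n' − n ⟹ ‖x^{n'} − x^n‖ ≤ ‖x − 1‖·p^{−K}`).
* §2 the bump: `‖e‖ ≤ t < 1 ⟹ ‖1 − (1 − e^N)^N‖ ≤ t^N` (`R1.norm_bump_le`) and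
  `‖e − 1‖ ≤ t < 1 ⟹ ‖(1 − (1 − e^N)^N) − 1‖ ≤ t^N` (`R1.norm_bump_sub_one_le`, `N ≥ 1`).

References: [Washington1997] §5.1; [Serre1973] Ch. II §3 (principal units).
-/

noncomputable section

open scoped Classical Topology
open Filter Finset
open Summit.BirchSwinnertonDyer.Rank1Residual.X11b.Three.LambdaSupply.PadicUnits

namespace Summit.BirchSwinnertonDyer.Rank1Residual.X11b

variable {p : ℕ} [Fact p.Prime]

/-! ### §1 Powers of a principal unit close to `1` -/

/-- `‖(m : ℂ_p)‖ = ‖(m : ℚ_p)‖`. [folklore] -/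
theorem R1.norm_natCast_padicComplex (m : ℕ) : ‖(m : ℂ_[p])‖ = ‖(m : ℚ_[p])‖ := by
  rw [← map_natCast (algebraMap ℚ_[p] ℂ_[p]) m, norm_algebraMap']

/-- A power of a principal unit is within `‖x − 1‖` of `1`: `‖x^k − 1‖ ≤ ‖x − 1‖`. [folklore] -/
theorem R1.norm_pow_sub_one_le {x : ℂ_[p]} (hx : ‖x - 1‖ < 1) (k : ℕ) : ‖x ^ k - 1‖ ≤ ‖x - 1‖ := by
  rw [← norm_neg, neg_sub, ← norm_neg (x - 1), neg_sub]
  exact norm_one_sub_pow_le (by rwa [← norm_neg, neg_sub]) k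

/-- **`‖x^p − 1‖ = p⁻¹·‖x − 1‖` for `‖x − 1‖ < p⁻¹`**: `x^p − 1 = (Σ_{i<p} x^i)(x − 1)` and
`Σ_{i<p} x^i = p + Σ_{i<p}(x^i − 1)` has norm exactly `‖p‖ = p⁻¹` (each `‖x^i − 1‖ ≤ ‖x − 1‖ < p⁻¹`).
[cite: Washington1997, §5.1] -/
theorem R1.norm_pow_prime_sub_one {x : ℂ_[p]} (hx : ‖x - 1‖ < (p : ℝ)⁻¹) :
    ‖x ^ p - 1‖ = (p : ℝ)⁻¹ * ‖x - 1‖ := by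
  have hp : p.Prime := Fact.out
  have hp1 : (p : ℝ)⁻¹ ≤ 1 := inv_le_one_of_one_le₀ (by exact_mod_cast hp.one_lt.le)
  have hx1 : ‖x - 1‖ < 1 := hx.trans_le hp1
  have hS : ‖∑ i ∈ range p, x ^ i‖ = (p : ℝ)⁻¹ := by
    have hdec : ∑ i ∈ range p, x ^ i = (p : ℂ_[p]) + ∑ i ∈ range p, (x ^ i - 1) := by
      rw [sum_sub_distrib, sum_const, card_range, nsmul_eq_mul, mul_one]; ring
    rw [← Literature.NumberTheory.LFunctions.Dwork.norm_natCast_p_padicComplex (p := p)]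
    refine norm_eq_of_norm_sub_lt ?_
    rw [hdec, add_sub_cancel_left, Literature.NumberTheory.LFunctions.Dwork.norm_natCast_p_padicComplex]
    have h0 : (0 : ℝ) ≤ ‖x - 1‖ := norm_nonneg _
    calc ‖∑ i ∈ range p, (x ^ i - 1)‖ ≤ ‖x - 1‖ :=
          IsUltrametricDist.norm_sum_le_of_forall_le_of_nonneg h0 fun i _ => R1.norm_pow_sub_one_le hx1 i
      _ < (p : ℝ)⁻¹ := hx
  have hfac : x ^ p - 1 = (∑ i ∈ range p, x ^ i) * (x - 1) := (geom_sum_mul x p).symm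
  rw [hfac, norm_mul, hS]

/-- `‖x^{p^a} − 1‖ = p^{−a}·‖x − 1‖` for `‖x − 1‖ < p⁻¹`. [cite: Washington1997, §5.1] -/
theorem R1.norm_pow_prime_pow_sub_one {x : ℂ_[p]} (hx : ‖x - 1‖ < (p : ℝ)⁻¹) (a : ℕ) :
    ‖x ^ p ^ a - 1‖ = ((p : ℝ)⁻¹) ^ a * ‖x - 1‖ := by
  have hp : p.Prime := Fact.out
  have hp1 : (p : ℝ)⁻¹ ≤ 1 := inv_le_one_of_one_le₀ (by exact_mod_cast hp.one_lt.le)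
  induction a with
  | zero => simp
  | succ a ih =>
    have hxa : ‖x ^ p ^ a - 1‖ < (p : ℝ)⁻¹ := by
      rw [ih]
      calc ((p : ℝ)⁻¹) ^ a * ‖x - 1‖ ≤ 1 * ‖x - 1‖ :=
            mul_le_mul_of_nonneg_right (pow_le_one₀ (by positivity) hp1) (norm_nonneg _)
        _ < (p : ℝ)⁻¹ := by rw [one_mul]; exact hx
    rw [pow_succ, pow_mul, R1.norm_pow_prime_sub_one hxa, ih, pow_succ]
    ring

/-- For `p ∤ u` and a principal unit `y`: `‖y^u − 1‖ = ‖y − 1‖` (the cofactor `Σ_{i<u} y^i` has norm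
`‖u‖ = 1`, x11b3-p7's `norm_geom_sum_eq_one`). [cite: Serre1973, Ch. II §3.1] -/
theorem R1.norm_pow_sub_one_of_coprime {y : ℂ_[p]} (hy : ‖y - 1‖ < 1) {u : ℕ} (hu : p.Coprime u) :
    ‖y ^ u - 1‖ = ‖y - 1‖ := by
  have hy' : ‖1 - y‖ < 1 := by rwa [← norm_neg, neg_sub]
  have hfac : y ^ u - 1 = (∑ i ∈ range u, y ^ i) * (y - 1) := (geom_sum_mul y u).symm
  rw [hfac, norm_mul, norm_geom_sum_eq_one (p := p) (F := ℂ_[p]) hy' hu, one_mul]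

/-- **`‖x^m − 1‖ = ‖x − 1‖·‖m‖_p` for `m ≥ 1` and `‖x − 1‖ < p⁻¹`** (`m = p^a u`, `p ∤ u`).
[cite: Washington1997, §5.1] -/
theorem R1.norm_pow_sub_one_eq {x : ℂ_[p]} (hx : ‖x - 1‖ < (p : ℝ)⁻¹) {m : ℕ} (hm : m ≠ 0) :
    ‖x ^ m - 1‖ = ‖x - 1‖ * ‖(m : ℚ_[p])‖ := by
  have hp : p.Prime := Fact.out
  have hp1 : (p : ℝ)⁻¹ ≤ 1 := inv_le_one_of_one_le₀ (by exact_mod_cast hp.one_lt.le)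
  obtain ⟨a, u, hu, rfl⟩ := Nat.exists_eq_pow_mul_and_not_dvd hm p hp.ne_one
  have hcop : p.Coprime u := (Nat.Prime.coprime_iff_not_dvd hp).mpr hu
  have hxa : ‖x ^ p ^ a - 1‖ < 1 := by
    rw [R1.norm_pow_prime_pow_sub_one hx a]
    calc ((p : ℝ)⁻¹) ^ a * ‖x - 1‖ ≤ 1 * ‖x - 1‖ :=
          mul_le_mul_of_nonneg_right (pow_le_one₀ (by positivity) hp1) (norm_nonneg _)
      _ < 1 := by rw [one_mul]; exact hx.trans_le hp1
  rw [pow_mul, R1.norm_pow_sub_one_of_coprime hxa hcop, R1.norm_pow_prime_pow_sub_one hx a,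
    Nat.cast_mul, Nat.cast_pow, norm_mul, norm_pow, Padic.norm_p,
    Padic.norm_natCast_eq_one_iff.mpr hcop]
  ring

/-- A principal unit has norm `1`: `‖x − 1‖ < 1 ⟹ ‖x‖ = 1`. [folklore] -/
theorem R1.norm_eq_one_of_norm_sub_one_lt {x : ℂ_[p]} (hx : ‖x - 1‖ < 1) : ‖x‖ = 1 := by
  have h : ‖x - 1‖ < ‖(1 : ℂ_[p])‖ := by rwa [norm_one]
  rw [norm_eq_of_norm_sub_lt h, norm_one]

/-- `‖x^n − 1‖ ≤ ‖x − 1‖·‖n‖_p` for every `n : ℤ` (`x` a principal unit with `‖x − 1‖ < p⁻¹`;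
for `n < 0` use `‖y⁻¹ − 1‖ = ‖y − 1‖`). [cite: Washington1997, §5.1] -/
theorem R1.norm_zpow_sub_one_le {x : ℂ_[p]} (hx : ‖x - 1‖ < (p : ℝ)⁻¹) (n : ℤ) :
    ‖x ^ n - 1‖ ≤ ‖x - 1‖ * ‖(n : ℚ_[p])‖ := by
  have hp : p.Prime := Fact.out
  have hp1 : (p : ℝ)⁻¹ ≤ 1 := inv_le_one_of_one_le₀ (by exact_mod_cast hp.one_lt.le)
  have hx1 : ‖x - 1‖ < 1 := hx.trans_le hp1
  -- natural exponents
  have hnat : ∀ m : ℕ, ‖x ^ m - 1‖ ≤ ‖x - 1‖ * ‖(m : ℚ_[p])‖ := by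
    intro m
    rcases eq_or_ne m 0 with rfl | hm
    · simp
    · exact (R1.norm_pow_sub_one_eq hx hm).le
  rcases Int.eq_nat_or_neg n with ⟨m, rfl | rfl⟩
  · rw [zpow_natCast, Int.cast_natCast]
    exact hnat m
  · rw [zpow_neg, zpow_natCast, Int.cast_neg, Int.cast_natCast, norm_neg]
    have hxm1 : ‖x ^ m - 1‖ < 1 := (R1.norm_pow_sub_one_le hx1 m).trans_lt hx1
    have hn1 : ‖x ^ m‖ = 1 := R1.norm_eq_one_of_norm_sub_one_lt hxm1
    rw [← norm_neg, neg_sub, norm_one_sub_inv_eq hn1, ← norm_neg, neg_sub]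
    exact hnat m

/-- **Congruent exponents give close powers**: for `n, n' : ℤ` with `p^K ∣ n' − n`,
`‖x^{n'} − x^n‖ ≤ ‖x − 1‖·p^{−K}` (`x^{n'} − x^n = x^n(x^{n'−n} − 1)`, `‖x^n‖ = 1`).
[cite: Washington1997, §5.1] -/
theorem R1.norm_zpow_sub_zpow_le_of_dvd {x : ℂ_[p]} (hx : ‖x - 1‖ < (p : ℝ)⁻¹) {n n' : ℤ} {K : ℕ}
    (hK : (p ^ K : ℤ) ∣ n' - n) : ‖x ^ n' - x ^ n‖ ≤ ‖x - 1‖ * (p : ℝ) ^ (-(K : ℤ)) := by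
  have hp : p.Prime := Fact.out
  have hp1 : (p : ℝ)⁻¹ ≤ 1 := inv_le_one_of_one_le₀ (by exact_mod_cast hp.one_lt.le)
  have hx1 : ‖x - 1‖ < 1 := hx.trans_le hp1
  have hx0 : x ≠ 0 := by
    intro h; rw [h, zero_sub, norm_neg, norm_one] at hx1; exact lt_irrefl _ hx1
  have hxn : ‖x ^ n‖ = 1 := by
    have h := R1.norm_zpow_sub_one_le hx n
    have hlt : ‖x ^ n - 1‖ < 1 := lt_of_le_of_lt h (by
      calc ‖x - 1‖ * ‖(n : ℚ_[p])‖ ≤ ‖x - 1‖ * 1 :=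
            mul_le_mul_of_nonneg_left (Padic.norm_int_le_one n) (norm_nonneg _)
        _ < 1 := by rw [mul_one]; exact hx1)
    exact R1.norm_eq_one_of_norm_sub_one_lt hlt
  have hfac : x ^ n' - x ^ n = x ^ n * (x ^ (n' - n) - 1) := by
    rw [mul_sub, mul_one, ← zpow_add₀ hx0, add_sub_cancel]
  rw [hfac, norm_mul, hxn, one_mul]
  refine (R1.norm_zpow_sub_one_le hx (n' - n)).trans ?_
  refine mul_le_mul_of_nonneg_left ?_ (norm_nonneg _)
  have h := (Padic.norm_int_le_pow_iff_dvd (n' - n) K).mpr hK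
  simpa only [Int.cast_sub] using h

/-! ### §2 The bump `1 − (1 − eᴺ)ᴺ` -/

/-- **Bump, small side**: `‖e‖ ≤ t < 1`, `N ≥ 1` ⟹ `‖1 − (1 − e^N)^N‖ ≤ t^N`
(`(1 − w)^N − 1 = Σ_{m=1}^{N} C(N,m)(−w)^m`, `w = e^N`, each term of norm `≤ ‖w‖`). [folklore] -/
theorem R1.norm_bump_le {e : ℂ_[p]} {t : ℝ} (ht0 : 0 ≤ t) (ht1 : t < 1) (he : ‖e‖ ≤ t) (N : ℕ) :
    ‖1 - (1 - e ^ N) ^ N‖ ≤ t ^ N := by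
  set w : ℂ_[p] := e ^ N with hw
  have hwN : ‖w‖ ≤ t ^ N := by rw [hw, norm_pow]; exact pow_le_pow_left₀ (norm_nonneg _) he N
  have hw1 : ‖w‖ ≤ 1 := hwN.trans (pow_le_one₀ ht0 ht1.le)
  -- `(1 - w)^N = 1 + Σ_{m<N} (-w)^(m+1) C(N, m+1)`
  have hexp : (1 - w) ^ N = 1 + ∑ m ∈ range N, (-w) ^ (m + 1) * (N.choose (m + 1) : ℂ_[p]) := by
    have h := add_pow (-w) 1 N
    simp only [one_pow, mul_one] at h
    rw [sub_eq_add_neg, add_comm, h, sum_range_succ', pow_zero, Nat.choose_zero_right, Nat.cast_one,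
      one_mul, add_comm]
  have hrew : (1 : ℂ_[p]) - (1 - w) ^ N = -∑ m ∈ range N, (-w) ^ (m + 1) * (N.choose (m + 1) : ℂ_[p]) := by
    rw [hexp]; ring
  rw [hrew, norm_neg]
  refine IsUltrametricDist.norm_sum_le_of_forall_le_of_nonneg (pow_nonneg ht0 _) fun m _ => ?_
  rw [norm_mul, norm_pow, norm_neg]
  have hc : ‖(N.choose (m + 1) : ℂ_[p])‖ ≤ 1 := by
    rw [← Int.cast_natCast, Literature.NumberTheory.LFunctions.Dwork.norm_intCast_padicComplex]
    exact Padic.norm_int_le_one _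
  calc ‖w‖ ^ (m + 1) * ‖(N.choose (m + 1) : ℂ_[p])‖ ≤ ‖w‖ ^ (m + 1) * 1 :=
        mul_le_mul_of_nonneg_left hc (pow_nonneg (norm_nonneg _) _)
    _ ≤ ‖w‖ := by
        rw [mul_one, pow_succ]
        exact mul_le_of_le_one_left (norm_nonneg _) (pow_le_one₀ (norm_nonneg _) hw1)
    _ ≤ t ^ N := hwN

/-- **Bump, unit side**: `‖e − 1‖ ≤ t < 1`, `N ≥ 1` ⟹ `‖(1 − (1 − e^N)^N) − 1‖ ≤ t^N`
(`‖e^N − 1‖ ≤ ‖e − 1‖ ≤ t` for the principal unit `e`, and `(1 − (1 − e^N)^N) − 1 = −(1 − e^N)^N`).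
[folklore] -/
theorem R1.norm_bump_sub_one_le {e : ℂ_[p]} {t : ℝ} (ht1 : t < 1) (he : ‖e - 1‖ ≤ t) (N : ℕ) :
    ‖(1 - (1 - e ^ N) ^ N) - 1‖ ≤ t ^ N := by
  have he1 : ‖e ^ N - 1‖ ≤ t := (R1.norm_pow_sub_one_le (he.trans_lt ht1) N).trans he
  have hrew : ((1 : ℂ_[p]) - (1 - e ^ N) ^ N) - 1 = -((1 - e ^ N) ^ N) := by ring
  rw [hrew, norm_neg, norm_pow, ← norm_neg, neg_sub]
  exact pow_le_pow_left₀ (norm_nonneg _) he1 N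

end Summit.BirchSwinnertonDyer.Rank1Residual.X11b

end
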